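import Literature.AlgebraicGeometry.HodgeTheory.EigenblockSection
import Literature.AlgebraicGeometry.HodgeTheory.StabilizerRestrictionHom
import Literature.AlgebraicGeometry.HodgeTheory.CyclicReflectionEigenprojectors
import Literature.AlgebraicGeometry.HodgeTheory.HermitianFormEigenspaceNondegenerate
import Literature.AlgebraicGeometry.HodgeTheory.GoursatKolchinRibetCriterion
import HarnessLib

/-!
# The block section for the eigenspaces of a cyclic isometry: `Γ ⊗ ℂ` and the commutator
# `g h g⁻¹ h⁻¹` are recovered from HALF their eigenblocks (lane D of crux K1, hole S6; Carlson–Toledo 1999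
# §2/§5: `V ⊗ ℂ = ⊕ H(μ)`, `B_ℂ` pairs `H(μ)` with `H(μ⁻¹)`; Katz 1990 §1.8)

Family `hodge`, layer `Literature/AlgebraicGeometry/HodgeTheory`. THEOREMS; layer L3 (instantiation) of hole S6
of the lane-D glue `stub_unitaryCommutatorsInMon_of_facts` of `stmt-HodgeConjecture-19544` (memo
LANE-D-ROADMAP-v2-Ax-g0 §2 S6), on top of `EigenblockSection` (generic section) and `PerfectPairingTranspose`.
Setting: `τ : V →ₗ[ℚ] V` with `τ^p = 1` preserving a symmetric non-degenerate `B`, `ζ` a primitive `p`-th root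
of unity, a HALF SYSTEM of exponents `e : J → {1, …, p−1}` (injective, `e i + e j ≠ p`, and every
`1 ≤ m < p` is an `e i` or a `p − e i`) with blocks `E i = H(ζ^{e i})`, and a subgroup `Γ ≤ GL_ℚ(V)` commuting
with `τ`, preserving `B` and fixing `V^τ` pointwise. Then (`exists_cyclicEigenblockSection`) there are bases,
an `End`-valued map `Φ : GL(Π_i E_i) → End(V ⊗ ℂ)` with entries in `ℂ[x, 1/det]`, and for any two
`τ`-commuting `B`-isometries `g, h` (with `dim V^τ ≤ 1`) automorphisms `u_i ∈ SL(E_i)` such that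
`Φ ∘ ψ = id` on `Γ ⊗ ℂ` (`ψ` = block-diagonal of the restrictions, `piRestrictHom`/`blockDiagHom`) and
`Φ(⊕ u_i) = (g h g⁻¹ h⁻¹) ⊗ ℂ` — exactly the input of the identity-component transport
`mem_glIdentityComponent_of_rationalMap_end`. Ingredients: the eigen-projectors `π_j`
(`CyclicReflectionEigenprojectors`: `Σ π_j = 1`, `π_j|H(ζ^k) = δ_{jk}`), `B_ℂ(H(μ), H(μ')) = 0` unless `μμ' = 1`
and non-degeneracy of `B_ℂ` (`HermitianFormEigenspaceNondegenerate`) making `B_ℂ : H(ζ^m) × H(ζ^{p−m}) → ℂ`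
perfect, and `dim V^τ ≤ 1` making the commutator trivial on `H(1)`.
Written by the prover seat `hodge-nonav-prover-A` (cell `hodge-nonav`).

## References
* [CarlsonToledo1999] J. A. Carlson, D. Toledo, *Discriminant complements and kernels of monodromy
  representations*, Duke Math. J. 97 (1999), §2 (p. 5), §5 (p. 11).
* [Katz1990ESDE] N. M. Katz, *Exponential Sums and Differential Equations*, Ann. of Math. Stud. 124 (1990),
  §1.8 Prop. 1.8.2.
-/

noncomputable section

open Module Literature.AlgebraicGeometry.Motives
open scoped TensorProduct

namespace Literature.AlgebraicGeometry.HodgeTheory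

universe v

variable {V : Type v} [AddCommGroup V] [Module ℚ V] [Module.Finite ℚ V]

/-! ### §1 Automorphisms fixing `V^τ` fix `H(1) = H(ζ^0)` after complexification -/

omit [Module.Finite ℚ V] in
/-- Base change commutes with finite sums of linear maps. [folklore] -/
private theorem baseChange_finset_sum {ι : Type*} (s : Finset ι) (f : ι → V →ₗ[ℚ] V) :
    (∑ i ∈ s, f i).baseChange ℂ = ∑ i ∈ s, (f i).baseChange ℂ := by
  classical
  induction s using Finset.induction_on with
  | empty => rw [Finset.sum_empty, Finset.sum_empty, LinearMap.baseChange_zero]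
  | insert a s ha ih => rw [Finset.sum_insert ha, Finset.sum_insert ha, LinearMap.baseChange_add, ih]

omit [Module.Finite ℚ V] in
/-- **If `f` fixes `V^τ` pointwise then `f ⊗ ℂ` fixes `H(ζ^0) = H(1)` pointwise**: `H(1)` is the image of the
projector `π_0 = (1/p) Σ τ_ℂ^i = ((1/p) Σ τ^i) ⊗ ℂ`, whose rational values lie in `V^τ`.
[cite: CarlsonToledo1999, §2 (p. 5)] -/
theorem baseChange_apply_of_mem_eigenspace_pow_zero {τ : V →ₗ[ℚ] V} {p : ℕ} (hp : 0 < p) (hτ : τ ^ p = 1)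
    {ζ : ℂ} (hζ0 : ζ ≠ 0) {f : V →ₗ[ℚ] V} (hf : ∀ v, τ v = v → f v = v) {x : ℂ ⊗[ℚ] V}
    (hx : x ∈ Module.End.eigenspace (τ.baseChange ℂ) (ζ ^ 0)) : f.baseChange ℂ x = x := by
  -- `S := Σ_{i<p} τ^i` takes values in `V^τ`, so `f ∘ S = S`
  set S : V →ₗ[ℚ] V := ∑ i ∈ Finset.range p, τ ^ i with hS
  have hSτ : ∀ v, τ (S v) = S v := by
    intro v
    rw [hS, LinearMap.sum_apply, map_sum]
    have h : ∀ i, τ ((τ ^ i) v) = (τ ^ (i + 1)) v := fun i => by rw [pow_succ', Module.End.mul_apply]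
    simp_rw [h]
    obtain ⟨n, hn⟩ : ∃ n, p = n + 1 := ⟨p - 1, (Nat.sub_add_cancel hp).symm⟩
    rw [hn, Finset.sum_range_succ, Finset.sum_range_succ' (fun i => (τ ^ i) v), ← hn, hτ, pow_zero]
  have hfS : f ∘ₗ S = S := LinearMap.ext fun v => hf _ (hSτ v)
  have hfSC : f.baseChange ℂ ∘ₗ S.baseChange ℂ = S.baseChange ℂ := by rw [← LinearMap.baseChange_comp, hfS]
  have hSC : S.baseChange ℂ = ∑ i ∈ Finset.range p, (τ.baseChange ℂ) ^ i := by
    rw [hS, baseChange_finset_sum]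
    exact Finset.sum_congr rfl fun i _ => by rw [LinearMap.baseChange_pow]
  -- `x = π_0 x = p⁻¹ • S_ℂ x`
  have hπ : cyclicEigenProjector τ p ζ 0 x = x := cyclicEigenProjector_apply_of_mem_eigenspace_self hp.ne' hζ0 0 hx
  have hπS : cyclicEigenProjector τ p ζ 0 x = (p : ℂ)⁻¹ • S.baseChange ℂ x := by
    rw [cyclicEigenProjector_apply, hSC, LinearMap.sum_apply]
    simp only [mul_zero, pow_zero, one_smul]
  rw [← hπ, hπS, map_smul]
  congr 1
  exact congrArg (fun u => u x) hfSC

/-- **A commutator of `τ`-commuting automorphisms is trivial on `V^τ` when `dim V^τ ≤ 1`.**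
[cite: CarlsonToledo1999, §2 (p. 5)] -/
theorem commutator_apply_of_finrank_eigenspace_one_le_one {τ : V →ₗ[ℚ] V}
    (hfix : finrank ℚ (Module.End.eigenspace τ 1) ≤ 1) {g h : V ≃ₗ[ℚ] V} (hg : ∀ x, g (τ x) = τ (g x))
    (hh : ∀ x, h (τ x) = τ (h x)) (v : V) (hv : τ v = v) : (g * h * g⁻¹ * h⁻¹) v = v := by
  set L := Module.End.eigenspace τ 1 with hL
  have hmem : ∀ w, w ∈ L ↔ τ w = w := fun w => by rw [hL, Module.End.mem_eigenspace_iff, one_smul]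
  -- `g⁻¹`, `h⁻¹` (indeed any `τ`-commuting automorphism) preserve `L`
  have hinv : ∀ {e : V ≃ₗ[ℚ] V}, (∀ x, e (τ x) = τ (e x)) → ∀ x, e.symm (τ x) = τ (e.symm x) := by
    intro e he x
    apply e.injective
    rw [he, LinearEquiv.apply_symm_apply, LinearEquiv.apply_symm_apply]
  have hpres : ∀ {e : V ≃ₗ[ℚ] V}, (∀ x, e (τ x) = τ (e x)) → ∀ w ∈ L, e w ∈ L := by
    intro e he w hw
    rw [hmem] at hw ⊢
    rw [← he, hw]
  -- two endomorphisms of a space of dimension `≤ 1` commute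
  obtain ⟨v₀, hv₀⟩ := finrank_le_one_iff.mp hfix
  have hscal : ∀ {e : V ≃ₗ[ℚ] V}, (∀ x, e (τ x) = τ (e x)) → ∃ a : ℚ, ∀ w ∈ L, e w = a • w := by
    intro e he
    obtain ⟨a, ha⟩ := hv₀ ⟨e v₀, hpres he _ v₀.2⟩
    refine ⟨a, fun w hw => ?_⟩
    obtain ⟨c, hc⟩ := hv₀ ⟨w, hw⟩
    have hw' : w = c • (v₀ : V) := by simpa using (congrArg Subtype.val hc).symm
    have hev : e v₀ = a • (v₀ : V) := by simpa using (congrArg Subtype.val ha).symm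
    rw [hw', map_smul, hev, smul_comm]
  obtain ⟨a, ha⟩ := hscal hg
  obtain ⟨b, hb⟩ := hscal hh
  -- `w := g⁻¹ h⁻¹ v ∈ L`, and `g h w = h g w`
  have hvL : v ∈ L := (hmem v).2 hv
  set w := g.symm (h.symm v) with hw
  have hwL : w ∈ L := hpres (hinv hg) _ (hpres (hinv hh) _ hvL)
  have hcomm : g (h w) = h (g w) := by
    rw [hb w hwL, map_smul, ha w hwL, map_smul, hb w hwL, smul_comm]
  change g (h (g.symm (h.symm v))) = v
  rw [← hw, hcomm, hw, LinearEquiv.apply_symm_apply, LinearEquiv.apply_symm_apply]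

omit [Module.Finite ℚ V] in
/-- **Vectors fixed by the generators are fixed by the group they generate** (used with
`cyclicReflection_apply_of_apply_eq_self`: the reflections `r_δ` fix `V^τ`, hence so does the monodromy
group `Γ = ⟨r_δ⟩`). [cite: CarlsonToledo1999, §6 Proposition 2 (p. 14)] -/
theorem apply_eq_self_of_mem_closure {K : Type*} [Field K] {M : Type*} [AddCommGroup M] [Module K M]
    {S : Set (M ≃ₗ[K] M)} {v : M} (hS : ∀ s ∈ S, s v = v) {γ : M ≃ₗ[K] M} (hγ : γ ∈ Subgroup.closure S) :
    γ v = v := by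
  induction hγ using Subgroup.closure_induction with
  | mem s hs => exact hS s hs
  | one => rfl
  | mul g g' _ _ hg hg' => rw [LinearEquiv.mul_apply, hg', hg]
  | inv g _ hg =>
    change g.symm v = v
    conv_lhs => rw [← hg]
    exact g.symm_apply_apply v

/-! ### §2 `B_ℂ : H(ζ^m) × H(ζ^{p−m}) → ℂ` is a perfect pairing -/

/-- **`B_ℂ` restricted to `H(ζ^m) × H(ζ^{p−m})` is perfect** (`1 ≤ m < p`): a vector of `H(ζ^m)` orthogonal to
`H(ζ^{p−m})` is orthogonal to every `H(ζ^j)` (`B_ℂ(H(μ), H(μ')) = 0` unless `μμ' = 1`), hence to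
`V ⊗ ℂ = Σ_j H(ζ^j)`, hence zero. [cite: CarlsonToledo1999, §5 (p. 11)] -/
theorem isPerfPair_baseChange_domRestrict_eigenspace {B : LinearMap.BilinForm ℚ V} (hBs : B.IsSymm)
    (hBn : B.Nondegenerate) {τ : V →ₗ[ℚ] V} {p : ℕ} (hp : 0 < p) (hτ : τ ^ p = 1)
    (hτB : ∀ x y, B (τ x) (τ y) = B x y) {ζ : ℂ} (hζ : IsPrimitiveRoot ζ p) {m : ℕ} (hm1 : 1 ≤ m) (hmp : m < p)
    (P Q : Submodule ℂ (ℂ ⊗[ℚ] V)) (hP : P = Module.End.eigenspace (τ.baseChange ℂ) (ζ ^ m))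
    (hQ : Q = Module.End.eigenspace (τ.baseChange ℂ) (ζ ^ (p - m))) :
    ((B.baseChange ℂ).domRestrict₁₂ P Q).IsPerfPair := by
  have hζ0 : ζ ≠ 0 := hζ.ne_zero hp.ne'
  haveI : FiniteDimensional ℂ P := FiniteDimensional.finiteDimensional_submodule P
  -- orthogonality of `H(ζ^a)` and `H(ζ^j)` unless `p ∣ a + j`
  have horth : ∀ {a j : ℕ} {x y : ℂ ⊗[ℚ] V}, ¬ p ∣ a + j →
      x ∈ Module.End.eigenspace (τ.baseChange ℂ) (ζ ^ a) → y ∈ Module.End.eigenspace (τ.baseChange ℂ) (ζ ^ j) →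
      B.baseChange ℂ x y = 0 := by
    intro a j x y hdvd hx hy
    refine baseChange_eq_zero_of_mem_eigenspace hτB (fun h1 => hdvd ?_) hx hy
    rw [← pow_add] at h1
    exact (hζ.pow_eq_one_iff_dvd _).1 h1
  -- a vector of `H(ζ^a)` orthogonal to `H(ζ^c)` with `a + c = p` is zero
  have hsep : ∀ {a c : ℕ}, 1 ≤ a → a < p → a + c = p → ∀ x ∈ Module.End.eigenspace (τ.baseChange ℂ) (ζ ^ a),
      (∀ y ∈ Module.End.eigenspace (τ.baseChange ℂ) (ζ ^ c), B.baseChange ℂ x y = 0) → x = 0 := by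
    intro a c ha1 hap hac x hx hy
    refine eq_zero_of_forall_baseChange_eq_zero hBs hBn x fun z => ?_
    rw [← sum_cyclicEigenProjector (τ := τ) hζ hp z, map_sum]
    refine Finset.sum_eq_zero fun j hj => ?_
    rw [Finset.mem_range] at hj
    by_cases hjc : j = c
    · subst hjc
      exact hy _ (cyclicEigenProjector_mem_eigenspace hτ hζ.pow_eq_one hζ0 j z)
    · refine horth (fun hdvd => hjc ?_) hx (cyclicEigenProjector_mem_eigenspace hτ hζ.pow_eq_one hζ0 j z)
      obtain ⟨q, hq⟩ := hdvd
      have hq2 : q < 2 := by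
        by_contra hq2
        have : p * 2 ≤ p * q := Nat.mul_le_mul_left p (by omega)
        omega
      interval_cases q <;> omega
  subst hP hQ
  refine isPerfPair_of_separating _ (fun x hx => Subtype.ext ?_) (fun y hy => Subtype.ext ?_)
  · refine hsep (a := m) (c := p - m) hm1 hmp (by omega) x.1 x.2 fun y hy' => ?_
    have h := hx ⟨y, hy'⟩
    rwa [LinearMap.domRestrict₁₂_apply] at h
  · refine hsep (a := p - m) (c := m) (by omega) (by omega) (Nat.sub_add_cancel hmp.le) y.1 y.2 fun x hx' => ?_
    have h := hy ⟨x, hx'⟩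
    rw [LinearMap.domRestrict₁₂_apply] at h
    rw [← h]
    exact (LinearMap.BilinForm.IsSymm.baseChange (A := ℂ) (LinearMap.BilinForm.isSymm_iff.1 hBs)).eq _ _

/-! ### §3 Half systems of exponents: `Σ_{j<p} f j = f 0 + Σ_i (f (e i) + f (p − e i))` -/

/-- **Reindexing along a half system**: if `e : J → {1, …, p−1}` is injective, no two values sum to `p`, and
every `1 ≤ m < p` is a value or `p` minus a value, then `{0, …, p−1} = {0} ⊔ e(J) ⊔ (p − e(J))`.
[cite: CarlsonToledo1999, §2 (p. 5)] -/
theorem sum_range_eq_sum_halfSystem {M : Type*} [AddCommMonoid M] {J : Type*} [Fintype J] [DecidableEq J]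
    {p : ℕ} (hp : 0 < p) (e : J → ℕ) (he : ∀ i, 1 ≤ e i ∧ e i < p) (hinj : Function.Injective e)
    (hne : ∀ i j, e i + e j ≠ p) (hcov : ∀ m, 1 ≤ m → m < p → ∃ i, e i = m ∨ e i + m = p) (f : ℕ → M) :
    ∑ j ∈ Finset.range p, f j = f 0 + ∑ i, (f (e i) + f (p - e i)) := by
  classical
  have hset : Finset.range p = insert 0 (Finset.univ.image e ∪ Finset.univ.image fun i => p - e i) := by
    ext j
    simp only [Finset.mem_range, Finset.mem_insert, Finset.mem_union, Finset.mem_image, Finset.mem_univ, true_and]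
    constructor
    · intro hj
      rcases Nat.eq_zero_or_pos j with rfl | hj1
      · exact Or.inl rfl
      · obtain ⟨i, hi | hi⟩ := hcov j hj1 hj
        · exact Or.inr (Or.inl ⟨i, hi⟩)
        · exact Or.inr (Or.inr ⟨i, by omega⟩)
    · rintro (rfl | ⟨i, rfl⟩ | ⟨i, rfl⟩)
      · exact hp
      · exact (he i).2
      · have := (he i).1
        omega
  have h0 : (0 : ℕ) ∉ Finset.univ.image e ∪ Finset.univ.image fun i => p - e i := by
    simp only [Finset.mem_union, Finset.mem_image, Finset.mem_univ, true_and, not_or, not_exists]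
    exact ⟨fun i hi => by have := (he i).1; omega, fun i hi => by have := (he i).2; omega⟩
  have hdisj : Disjoint (Finset.univ.image e) (Finset.univ.image fun i => p - e i) := by
    rw [Finset.disjoint_left]
    simp only [Finset.mem_image, Finset.mem_univ, true_and, not_exists]
    rintro _ ⟨i, rfl⟩ j hj
    have := (he j).2
    exact hne i j (by omega)
  have hinj' : Function.Injective fun i => p - e i := fun i j hij => by
    have := (he i).2; have := (he j).2
    exact hinj (by simp only at hij; omega)
  rw [hset, Finset.sum_insert h0, Finset.sum_union hdisj, Finset.sum_image fun i _ j _ h => hinj h,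
    Finset.sum_image fun i _ j _ h => hinj' h, Finset.sum_add_distrib]

/-! ### §4 The section for `Γ ⊗ ℂ` and the commutator -/

/-- **The block section for the cyclic monodromy (hole S6 of the lane-D glue).** For a half system of
exponents `e` with blocks `E i = H(ζ^{e i})`, there are bases `b` of `Π_i E_i` and `c` of `V ⊗ ℂ`, an
`End`-valued map `Φ` whose matrix is `F([x]_b, 1/det [x]_b)` (`F` over `ℂ[x][y]`), and automorphisms `u_i` of
the `E_i` of determinant `1`, such that `Φ` inverts the block-diagonal restriction `ψ` on `Γ ⊗ ℂ` and carries
`⊕ u_i` to `(g h g⁻¹ h⁻¹) ⊗ ℂ`. (`Γ` commutes with `τ`, preserves `B`, fixes `V^τ`; `g, h` commute with `τ`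
and preserve `B`; `dim V^τ ≤ 1`.) [cite: CarlsonToledo1999, §2 (p. 5) and §5 (p. 11)]
[cite: Katz1990ESDE, §1.8 Prop. 1.8.2] -/
theorem exists_cyclicEigenblockSection {B : LinearMap.BilinForm ℚ V} (hBs : B.IsSymm) (hBn : B.Nondegenerate)
    {τ : V →ₗ[ℚ] V} {p : ℕ} (hp : 0 < p) (hτ : τ ^ p = 1) (hτB : ∀ x y, B (τ x) (τ y) = B x y)
    {ζ : ℂ} (hζ : IsPrimitiveRoot ζ p) {J : Type} [Fintype J] [DecidableEq J] (e : J → ℕ)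
    (he : ∀ i, 1 ≤ e i ∧ e i < p) (hinj : Function.Injective e) (hne : ∀ i j, e i + e j ≠ p)
    (hcov : ∀ m, 1 ≤ m → m < p → ∃ i, e i = m ∨ e i + m = p)
    (E : J → Submodule ℂ (ℂ ⊗[ℚ] V)) (hE : ∀ i, E i = Module.End.eigenspace (τ.baseChange ℂ) (ζ ^ e i))
    {Γ : Subgroup (V ≃ₗ[ℚ] V)} (hΓτ : ∀ γ ∈ Γ, ∀ x, γ (τ x) = τ (γ x))
    (hΓB : ∀ γ ∈ Γ, ∀ x y, B (γ x) (γ y) = B x y) (hΓfix : ∀ γ ∈ Γ, ∀ v, τ v = v → γ v = v)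
    (hstabE : ∀ i, Γ.map (glBaseChangeHom ℚ ℂ V) ≤ submoduleStabilizer (E i))
    (hfix : finrank ℚ (Module.End.eigenspace τ 1) ≤ 1) {g h : V ≃ₗ[ℚ] V}
    (hgτ : ∀ x, g (τ x) = τ (g x)) (hgB : ∀ x y, B (g x) (g y) = B x y)
    (hhτ : ∀ x, h (τ x) = τ (h x)) (hhB : ∀ x y, B (h x) (h y) = B x y) :
    ∃ (b : Module.Basis (Σ i : J, Fin (finrank ℂ (E i))) ℂ (Π i, E i))
      (c : Module.Basis (Fin (finrank ℂ (ℂ ⊗[ℚ] V))) ℂ (ℂ ⊗[ℚ] V))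
      (Φ : ((Π i, E i) ≃ₗ[ℂ] (Π i, E i)) → Module.End ℂ (ℂ ⊗[ℚ] V))
      (F : Matrix (Fin (finrank ℂ (ℂ ⊗[ℚ] V))) (Fin (finrank ℂ (ℂ ⊗[ℚ] V)))
        (Polynomial (MvPolynomial ((Σ i : J, Fin (finrank ℂ (E i))) × (Σ i : J, Fin (finrank ℂ (E i)))) ℂ)))
      (u : Π i, (E i ≃ₗ[ℂ] E i)),
      (∀ x, LinearMap.toMatrix c c (Φ x) =
        (evalAtInvDet (LinearMap.toMatrix b b (x : Module.End ℂ (Π i, E i)))).mapMatrix F) ∧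
      (∀ θ : Γ.map (glBaseChangeHom ℚ ℂ V),
        Φ (((blockDiagHom fun i => ↥(E i)).comp (piRestrictHom E _ hstabE)) θ) =
          ((θ : ℂ ⊗[ℚ] V ≃ₗ[ℂ] ℂ ⊗[ℚ] V) : Module.End ℂ (ℂ ⊗[ℚ] V))) ∧
      (∀ i, LinearEquiv.det (u i) = 1) ∧
      Φ (blockDiagHom (fun i => ↥(E i)) u) =
        ((glBaseChangeHom ℚ ℂ V (g * h * g⁻¹ * h⁻¹) : ℂ ⊗[ℚ] V ≃ₗ[ℂ] ℂ ⊗[ℚ] V) : Module.End ℂ (ℂ ⊗[ℚ] V)) := by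
  classical
  have hζ0 : ζ ≠ 0 := hζ.ne_zero hp.ne'
  -- the other pieces: `N₀ = H(1)`, `Q i = H(ζ^{p − e i})`, and the pairing `β = B_ℂ`
  set N₀ : Submodule ℂ (ℂ ⊗[ℚ] V) := Module.End.eigenspace (τ.baseChange ℂ) (ζ ^ 0) with hN₀
  set Q : J → Submodule ℂ (ℂ ⊗[ℚ] V) := fun i => Module.End.eigenspace (τ.baseChange ℂ) (ζ ^ (p - e i)) with hQ
  set β : ℂ ⊗[ℚ] V →ₗ[ℂ] ℂ ⊗[ℚ] V →ₗ[ℂ] ℂ := B.baseChange ℂ with hβ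
  haveI hperf : ∀ i, (β.domRestrict₁₂ (E i) (Q i)).IsPerfPair := fun i =>
    isPerfPair_baseChange_domRestrict_eigenspace hBs hBn hp hτ hτB hζ (he i).1 (he i).2 (E i) (Q i) (hE i) rfl
  -- the projections (eigen-projectors, restricted to their images)
  have hπmem : ∀ (j : ℕ) (x : ℂ ⊗[ℚ] V), cyclicEigenProjector τ p ζ j x ∈ Module.End.eigenspace (τ.baseChange ℂ) (ζ ^ j) :=
    fun j x => cyclicEigenProjector_mem_eigenspace hτ hζ.pow_eq_one hζ0 j x
  let pr₀ : ℂ ⊗[ℚ] V →ₗ[ℂ] N₀ := (cyclicEigenProjector τ p ζ 0).codRestrict N₀ fun x => hπmem 0 x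
  let prP : ∀ i, ℂ ⊗[ℚ] V →ₗ[ℂ] E i := fun i =>
    (cyclicEigenProjector τ p ζ (e i)).codRestrict (E i) fun x => by rw [hE i]; exact hπmem (e i) x
  let prQ : ∀ i, ℂ ⊗[ℚ] V →ₗ[ℂ] Q i := fun i => (cyclicEigenProjector τ p ζ (p - e i)).codRestrict (Q i) fun x => hπmem _ x
  have hsum : ∀ m : ℂ ⊗[ℚ] V, (pr₀ m : ℂ ⊗[ℚ] V) + ∑ i, (((prP i m : E i) : ℂ ⊗[ℚ] V) + ((prQ i m : Q i) : ℂ ⊗[ℚ] V)) = m := by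
    intro m
    have h := sum_range_eq_sum_halfSystem hp e he hinj hne hcov fun j => cyclicEigenProjector τ p ζ j m
    rw [sum_cyclicEigenProjector hζ hp m] at h
    exact h.symm
  -- the section and its matrix
  let Φ := blockSection E Q N₀ β pr₀ prP prQ
  let bP : ∀ i, Module.Basis (Fin (finrank ℂ (E i))) ℂ (E i) := fun i => Module.finBasis ℂ (E i)
  have hfin : ∀ i, finrank ℂ (E i) = finrank ℂ (Q i) := fun i =>
    Module.finrank_of_isPerfPair (β.domRestrict₁₂ (E i) (Q i))
  let bQ : ∀ i, Module.Basis (Fin (finrank ℂ (E i))) ℂ (Q i) := fun i =>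
    (Module.finBasis ℂ (Q i)).reindex (finCongr (hfin i).symm)
  let b : Module.Basis (Σ i : J, Fin (finrank ℂ (E i))) ℂ (Π i, E i) := Pi.basis bP
  let c : Module.Basis (Fin (finrank ℂ (ℂ ⊗[ℚ] V))) ℂ (ℂ ⊗[ℚ] V) := Module.finBasis ℂ (ℂ ⊗[ℚ] V)
  obtain ⟨F, hF⟩ := toMatrix_blockSection E Q N₀ β pr₀ prP prQ c b bP bQ
  -- KEY: a rational automorphism commuting with `τ`, preserving `B` and fixing `V^τ` is the section of its blocks
  have key : ∀ (f : ℂ ⊗[ℚ] V ≃ₗ[ℂ] ℂ ⊗[ℚ] V) (γ : V ≃ₗ[ℚ] V), f = glBaseChangeHom ℚ ℂ V γ →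
      (∀ x, γ (τ x) = τ (γ x)) → (∀ x y, B (γ x) (γ y) = B x y) → (∀ v, τ v = v → γ v = v) →
      ∀ hmem : ∀ i, f ∈ submoduleStabilizer (E i),
        Φ (LinearEquiv.piCongrRight fun i => restrictLinearEquiv (E i) f (hmem i)) = (f : Module.End ℂ (ℂ ⊗[ℚ] V)) := by
    rintro f γ rfl hγτ hγB hγfix hmem
    have hc : (γ : V →ₗ[ℚ] V) ∘ₗ τ = τ ∘ₗ (γ : V →ₗ[ℚ] V) := LinearMap.ext fun x => hγτ x
    refine blockSection_piCongrRight_eq E Q N₀ β pr₀ prP prQ hsum _ (fun n => ?_) _ (fun i q => rfl) (fun i q => ?_)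
      (fun i q q' => ?_)
    · exact baseChange_apply_of_mem_eigenspace_pow_zero hp hτ hζ0 (f := (γ : V →ₗ[ℚ] V)) (fun v hv => hγfix v hv) n.2
    · exact ((mem_submoduleStabilizer_iff _ _).1 (glBaseChangeHom_mem_submoduleStabilizer_eigenspace hc _) q.1).1 q.2
    · exact baseChange_isometry hγB _ _
  -- commutation / isometry / fixing properties of the commutator `g h g⁻¹ h⁻¹`
  have hinvτ : ∀ {k : V ≃ₗ[ℚ] V}, (∀ x, k (τ x) = τ (k x)) → ∀ x, k⁻¹ (τ x) = τ (k⁻¹ x) := by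
    intro k hk x
    apply k.injective
    change k (k.symm (τ x)) = k (τ (k.symm x))
    rw [hk, LinearEquiv.apply_symm_apply, LinearEquiv.apply_symm_apply]
  have hinvB : ∀ {k : V ≃ₗ[ℚ] V}, (∀ x y, B (k x) (k y) = B x y) → ∀ x y, B (k⁻¹ x) (k⁻¹ y) = B x y := by
    intro k hk x y
    have h1 := hk (k.symm x) (k.symm y)
    rw [LinearEquiv.apply_symm_apply, LinearEquiv.apply_symm_apply] at h1
    exact h1.symm
  have hmulτ : ∀ {k k' : V ≃ₗ[ℚ] V}, (∀ x, k (τ x) = τ (k x)) → (∀ x, k' (τ x) = τ (k' x)) →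
      ∀ x, (k * k') (τ x) = τ ((k * k') x) := fun hk hk' x => by
    rw [LinearEquiv.mul_apply, LinearEquiv.mul_apply, hk', hk]
  have hmulB : ∀ {k k' : V ≃ₗ[ℚ] V}, (∀ x y, B (k x) (k y) = B x y) → (∀ x y, B (k' x) (k' y) = B x y) →
      ∀ x y, B ((k * k') x) ((k * k') y) = B x y := fun hk hk' x y => by
    rw [LinearEquiv.mul_apply, LinearEquiv.mul_apply, hk, hk']
  have hcτ : ∀ x, (g * h * g⁻¹ * h⁻¹) (τ x) = τ ((g * h * g⁻¹ * h⁻¹) x) :=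
    hmulτ (hmulτ (hmulτ hgτ hhτ) (hinvτ hgτ)) (hinvτ hhτ)
  have hcB : ∀ x y, B ((g * h * g⁻¹ * h⁻¹) x) ((g * h * g⁻¹ * h⁻¹) y) = B x y :=
    hmulB (hmulB (hmulB hgB hhB) (hinvB hgB)) (hinvB hhB)
  have hcfix : ∀ v, τ v = v → (g * h * g⁻¹ * h⁻¹) v = v :=
    commutator_apply_of_finrank_eigenspace_one_le_one hfix hgτ hhτ
  -- stabilisers of the blocks
  have hmemE : ∀ {k : V ≃ₗ[ℚ] V}, (∀ x, k (τ x) = τ (k x)) → ∀ i, glBaseChangeHom ℚ ℂ V k ∈ submoduleStabilizer (E i) := by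
    intro k hk i
    rw [hE i]
    exact glBaseChangeHom_mem_submoduleStabilizer_eigenspace (LinearMap.ext fun x => hk x) _
  -- the blocks of the commutator and their determinants
  let u : Π i, (E i ≃ₗ[ℂ] E i) := fun i =>
    restrictLinearEquiv (E i) (glBaseChangeHom ℚ ℂ V (g * h * g⁻¹ * h⁻¹)) (hmemE hcτ i)
  have hdet : ∀ i, LinearEquiv.det (u i) = 1 := by
    intro i
    let R := restrictEquivHom (E i) (submoduleStabilizer (E i)) le_rfl
    let gS : submoduleStabilizer (E i) := ⟨glBaseChangeHom ℚ ℂ V g, hmemE hgτ i⟩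
    let hS : submoduleStabilizer (E i) := ⟨glBaseChangeHom ℚ ℂ V h, hmemE hhτ i⟩
    have hu : u i = R (gS * hS * gS⁻¹ * hS⁻¹) := by
      change R ⟨glBaseChangeHom ℚ ℂ V (g * h * g⁻¹ * h⁻¹), hmemE hcτ i⟩ = _
      congr 1
      exact Subtype.ext (by simp only [map_mul, map_inv, Subgroup.coe_mul, Subgroup.coe_inv, gS, hS])
    rw [hu, map_mul, map_mul, map_mul, map_inv, map_inv, map_mul, map_mul, map_mul, map_inv, map_inv,
      mul_comm (LinearEquiv.det (R gS)) (LinearEquiv.det (R hS))]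
    group
  refine ⟨b, c, Φ, F, u, hF, fun θ => ?_, hdet, ?_⟩
  · -- `Φ ∘ ψ = id` on `Γ ⊗ ℂ`
    obtain ⟨γ, hγ, hγθ⟩ := Subgroup.mem_map.1 θ.2
    exact key θ.1 γ hγθ.symm (hΓτ γ hγ) (hΓB γ hγ) (hΓfix γ hγ) fun i => hstabE i θ.2
  · -- `Φ (⊕ u_i) = (g h g⁻¹ h⁻¹) ⊗ ℂ`
    exact key _ _ rfl hcτ hcB hcfix (hmemE hcτ)

/-- **Pointwise form** (the shape consumed by `mem_glIdentityComponent_of_evalAtInvDet_of_leftInverse`, hole S6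
of the lane-D glue skeleton): matrices of the elements of `Γ ⊗ ℂ` and of `(g h g⁻¹ h⁻¹) ⊗ ℂ` are the rational
family `P` evaluated at the matrices of their block-diagonal restrictions. [cite: CarlsonToledo1999, §2 (p. 5)]
[cite: Katz1990ESDE, §1.8 Prop. 1.8.2] -/
theorem exists_cyclicEigenblockSection_pointwise {B : LinearMap.BilinForm ℚ V} (hBs : B.IsSymm)
    (hBn : B.Nondegenerate) {τ : V →ₗ[ℚ] V} {p : ℕ} (hp : 0 < p) (hτ : τ ^ p = 1)
    (hτB : ∀ x y, B (τ x) (τ y) = B x y) {ζ : ℂ} (hζ : IsPrimitiveRoot ζ p) {J : Type} [Fintype J] [DecidableEq J]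
    (e : J → ℕ) (he : ∀ i, 1 ≤ e i ∧ e i < p) (hinj : Function.Injective e) (hne : ∀ i j, e i + e j ≠ p)
    (hcov : ∀ m, 1 ≤ m → m < p → ∃ i, e i = m ∨ e i + m = p)
    (E : J → Submodule ℂ (ℂ ⊗[ℚ] V)) (hE : ∀ i, E i = Module.End.eigenspace (τ.baseChange ℂ) (ζ ^ e i))
    {Γ : Subgroup (V ≃ₗ[ℚ] V)} (hΓτ : ∀ γ ∈ Γ, ∀ x, γ (τ x) = τ (γ x))
    (hΓB : ∀ γ ∈ Γ, ∀ x y, B (γ x) (γ y) = B x y) (hΓfix : ∀ γ ∈ Γ, ∀ v, τ v = v → γ v = v)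
    (hstabE : ∀ i, Γ.map (glBaseChangeHom ℚ ℂ V) ≤ submoduleStabilizer (E i))
    (hfix : finrank ℚ (Module.End.eigenspace τ 1) ≤ 1) {g h : V ≃ₗ[ℚ] V}
    (hgτ : ∀ x, g (τ x) = τ (g x)) (hgB : ∀ x y, B (g x) (g y) = B x y)
    (hhτ : ∀ x, h (τ x) = τ (h x)) (hhB : ∀ x y, B (h x) (h y) = B x y) :
    ∃ (b : Module.Basis (Σ i : J, Fin (finrank ℂ (E i))) ℂ (Π i, E i))
      (c : Module.Basis (Fin (finrank ℂ (ℂ ⊗[ℚ] V))) ℂ (ℂ ⊗[ℚ] V))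
      (P : Fin (finrank ℂ (ℂ ⊗[ℚ] V)) × Fin (finrank ℂ (ℂ ⊗[ℚ] V)) →
        Polynomial (MvPolynomial ((Σ i : J, Fin (finrank ℂ (E i))) × (Σ i : J, Fin (finrank ℂ (E i)))) ℂ))
      (u : Π i, (E i ≃ₗ[ℂ] E i)),
      (∀ θ : Γ.map (glBaseChangeHom ℚ ℂ V), ∀ kl,
        LinearMap.toMatrix c c (((θ : ℂ ⊗[ℚ] V ≃ₗ[ℂ] ℂ ⊗[ℚ] V)) : Module.End ℂ (ℂ ⊗[ℚ] V)) kl.1 kl.2 =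
          evalAtInvDet (LinearMap.toMatrix b b
            ((((blockDiagHom fun i => ↥(E i)).comp (piRestrictHom E _ hstabE)) θ) : Module.End ℂ (Π i, E i))) (P kl)) ∧
      (∀ i, LinearEquiv.det (u i) = 1) ∧
      (∀ kl, LinearMap.toMatrix c c ((glBaseChangeHom ℚ ℂ V (g * h * g⁻¹ * h⁻¹) : ℂ ⊗[ℚ] V ≃ₗ[ℂ] ℂ ⊗[ℚ] V) :
            Module.End ℂ (ℂ ⊗[ℚ] V)) kl.1 kl.2 =
          evalAtInvDet (LinearMap.toMatrix b b (blockDiagHom (fun i => ↥(E i)) u : Module.End ℂ (Π i, E i))) (P kl)) := by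
  obtain ⟨b, c, Φ, F, u, hF, hΦψ, hu, hΦu⟩ := exists_cyclicEigenblockSection hBs hBn hp hτ hτB hζ e he hinj hne
    hcov E hE hΓτ hΓB hΓfix hstabE hfix hgτ hgB hhτ hhB
  refine ⟨b, c, fun kl => F kl.1 kl.2, u, fun θ kl => ?_, hu, fun kl => ?_⟩
  · rw [← hΦψ θ, hF, RingHom.mapMatrix_apply, Matrix.map_apply]
  · rw [← hΦu, hF, RingHom.mapMatrix_apply, Matrix.map_apply]

end Literature.AlgebraicGeometry.HodgeTheory

end
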